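import Summits.QuantumFields.BalabanUV.T4Continuum.Support.NE7EtaCovariantJunction

/-!
# NE7EtaRegauging — route #1 of the NE7 crux, hardest stub S1∕L7b-background: the COVARIANT data of the interface request are
# GAUGE-INVARIANT (kernel): under a re-gauging `w` of run A's lattice, `(u, W, Z) ↦ (w·u, gaugeAct w W, dirGauge w Z)` preserves the
# representation, the η-weighted energy norm, and the three covariant Lipschitz quantities (Lip₁ᶜ)(Lip₂ᶜ)(Lip₂′ᶜ) EXACTLY

Cell `pub-balaban`, rung (B)+1 sub-cell t4, lineage `b2b-balaban-t4-ne7-p1`, generation 22 (CRUX PROVER NE7 #1, ruling e34b3e0c); crux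
skeleton `t4/skeletons/NE7-CRUX-R1.md` v1.6 §3ter; companion of `NE7EtaCovariantJunction` (p252431) and `NE7EtaRatesD4Cov`.  HONEST
FRAMING (page 1): FIXED FINITE T⁴, rung (B)+1; NE7, NE3 NOT PRINTED in [Balaban1984PropagatorsI]–[Balaban1989LargeFieldII] and NOT PROVED
here; continuum YM on T⁴ ⇐ BetaPertH ∧ nine spine estimates (0/9 proved); BetaPertH ⇐ (D1) ∧ (D4) ∧ CAP+tail; G-an2-4 gates asym, D1 and
NE2/3/4; NOT infinite volume, NOT mass gap, NOT Clay.

WHAT.  The substrate already has the intertwining `gaugeAct_vary : gaugeAct w (vary W Z s) = vary (gaugeAct w W) (dirGauge w Z) s`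
(`dirGauge w Z x κ = Ad (w (x + e κ)) (Z x κ)`, [Balaban1985Averaging] (11)∕(45)) and the covariance of the dressed curl `curl_gaugeAct`
(`AveragingDeficitLocality`).  THIS FILE records, for the objects of row NE3's root T-E_w and of the covariant interface request
(`NE7EtaCovariantJunction` docstring):
 * `gaugeAct_gaugeAct_eq_vary` — the representation transports: `gaugeAct u UA = vary W Z 1 ⇒ gaugeAct (w·u) UA = vary W^w Z^w 1`;
 * `energyNormW_regauge` — `energyNormW L k W^w Z^w F = energyNormW L k W Z F` (unitary `w`): T-E_w's energy conjunct is invariant;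
 * `covDiff_regauge`, `covDiff2_regauge`, `covCurlDiff_regauge` — the covariant first∕second differences of `Z` and the covariant
   differences of `d_W Z` transform by `Ad (w ·)`, hence (`norm_*`) have the SAME norms: (Lip₁ᶜ)(Lip₂ᶜ)(Lip₂′ᶜ) hold for `(W^w, Z^w)` with the
   same constants iff they hold for `(W, Z)`;
 * `covariantData_regauge` — the bundle: representation ∧ energy bound ∧ (Lip₁ᶜ) ∧ (Lip₂′ᶜ) ∧ (Lip₂ᶜ) for `(u, W, Z)` ⇒ the same for
   `(w·u, W^w, Z^w)`.
So the covariant form of the ask «T-E_w + (Lip₁ᶜ)(Lip₂ᶜ)(Lip₂′ᶜ)» does not depend on the gauge in which run B's once-averaged minimiser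
`W = rescale L (bavg L UB)` happens to be presented: row NE3 may choose the gauge.  (The PLAIN differences of WAKE-1's typing transform
with the mismatched conjugations `Ad (w (x + e μ + e κ))` vs `Ad (w (x + e κ))` and are not invariant — not formalised here.)
HONEST.  Algebra ([folklore]); nothing of NE3∕NE7 discharged; 0 def; 0 sorry; nothing printed is a hypothesis of a theorem.
-/

set_option autoImplicit false

open scoped BigOperators Matrix Matrix.Norms.L2Operator
open Finset

namespace Summit.QuantumFields.BalabanUV.T4Continuum.NE7EtaRegauging

open Literature.MathematicalPhysics.QuantumFieldTheory.Balaban1983to89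
open B7Prop1Explicit B7Prop2Explicit
open T4AveragingDeficitWall hiding Site Plane Plaq Bond
open T4AveragingDeficitNonAbelian (Ad_mul Ad_sub)
open AveragingDeficitTransport (norm_Ad_of_unitary)
open AveragingDeficitLocality (dirGauge gaugeAct_vary curl_gaugeAct norm_dirGauge)
open NE3EnergyWeightedShapes (energyNormW)

noncomputable section

variable {d : ℕ} {n : Type*} [Fintype n] [DecidableEq n]

/-! ## §1 The representation and the energy conjunct -/

/-- **THE REPRESENTATION TRANSPORTS**: `gaugeAct u UA = vary W Z 1 ⇒ gaugeAct (w·u) UA = vary (gaugeAct w W) (dirGauge w Z) 1`. [folklore] -/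
theorem gaugeAct_gaugeAct_eq_vary (w u : Site d → (Matrix n n ℂ)ˣ) {UA W : Site d → Fin d → (Matrix n n ℂ)ˣ}
    {Z : Site d → Fin d → Matrix n n ℂ} (hrep : gaugeAct u UA = vary W Z 1) :
    gaugeAct (w * u) UA = vary (gaugeAct w W) (dirGauge w Z) 1 := by
  have hmul : gaugeAct (w * u) UA = gaugeAct w (gaugeAct u UA) := by
    funext x μ
    simp only [gaugeAct, Pi.mul_apply, mul_inv_rev, mul_assoc]
  rw [hmul, hrep, gaugeAct_vary]

/-- **T-E_w's ENERGY CONJUNCT IS GAUGE INVARIANT**: `energyNormW L k (gaugeAct w W) (dirGauge w Z) F = energyNormW L k W Z F` for unitary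
`w` (the dressed curl is conjugated by `w` at the plaquette's base, the direction by `w` at the bond's end; norms unchanged). [folklore] -/
theorem energyNormW_regauge [Nonempty n] (L k : ℕ) {w : Site d → (Matrix n n ℂ)ˣ} (hw : ∀ x, w x ∈ unitaryUnits (Matrix n n ℂ))
    (W : Site d → Fin d → (Matrix n n ℂ)ˣ) (Z : Site d → Fin d → Matrix n n ℂ) (F : Finset (Site d)) :
    energyNormW L k (gaugeAct w W) (dirGauge w Z) F = energyNormW L k W Z F := by
  unfold energyNormW curlSq dirSq
  have hc : ∀ (x : Site d) (π : T4AveragingDeficitWall.Plane d),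
      ‖curl (gaugeAct w W) (dirGauge w Z) (x, π)‖ = ‖curl W Z (x, π)‖ := fun x π => by
    rw [curl_gaugeAct, norm_Ad_of_unitary (hw _)]
  simp only [hc, norm_dirGauge hw]

/-! ## §2 The covariant differences transform by conjugation -/

/-- (Lip₁ᶜ)'s quantity: `Ad (W^w (x + e κ) μ) (Z^w (x + e μ) κ) − Z^w x κ = Ad (w (x + e κ)) (Ad (W (x + e κ) μ) (Z (x + e μ) κ) − Z x κ)`. [folklore] -/
theorem covDiff_regauge (w : Site d → (Matrix n n ℂ)ˣ) (W : Site d → Fin d → (Matrix n n ℂ)ˣ) (Z : Site d → Fin d → Matrix n n ℂ)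
    (x : Site d) (κ μ : Fin d) :
    Ad (gaugeAct w W (x + e κ) μ) (dirGauge w Z (x + e μ) κ) - dirGauge w Z x κ
      = Ad (w (x + e κ)) (Ad (W (x + e κ) μ) (Z (x + e μ) κ) - Z x κ) := by
  have e1 : x + e μ + e κ = x + e κ + e μ := add_right_comm x (e μ) (e κ)
  simp only [dirGauge, gaugeAct, e1]
  rw [← Ad_mul, inv_mul_cancel_right, Ad_mul, ← Ad_sub]

/-- (Lip₂′ᶜ)'s quantity transforms likewise (covariant SECOND differences along `μ`). [folklore] -/
theorem covDiff2_regauge (w : Site d → (Matrix n n ℂ)ˣ) (W : Site d → Fin d → (Matrix n n ℂ)ˣ) (Z : Site d → Fin d → Matrix n n ℂ)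
    (y : Site d) (κ μ : Fin d) :
    Ad (gaugeAct w W (y + e κ) μ)
        (Ad (gaugeAct w W (y + e κ + e μ) μ) (dirGauge w Z (y + (2 : ℕ) • e μ) κ) - dirGauge w Z (y + e μ) κ)
      - (Ad (gaugeAct w W (y + e κ) μ) (dirGauge w Z (y + e μ) κ) - dirGauge w Z y κ)
      = Ad (w (y + e κ)) (Ad (W (y + e κ) μ) (Ad (W (y + e κ + e μ) μ) (Z (y + (2 : ℕ) • e μ) κ) - Z (y + e μ) κ)
          - (Ad (W (y + e κ) μ) (Z (y + e μ) κ) - Z y κ)) := by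
  -- the inner covariant difference at y + e μ, and the outer one at y
  have hin := covDiff_regauge w W Z (y + e μ) κ μ
  have e2 : y + e μ + e κ = y + e κ + e μ := add_right_comm y (e μ) (e κ)
  have e3 : y + e μ + e μ = y + (2 : ℕ) • e μ := by rw [two_nsmul, add_assoc]
  rw [e2, e3] at hin
  rw [hin, covDiff_regauge w W Z y κ μ]
  simp only [gaugeAct]
  rw [← Ad_mul, inv_mul_cancel_right, Ad_mul, ← Ad_sub]

/-- (Lip₂ᶜ)'s quantity: the covariant difference of the dressed curl transforms by `Ad (w x)`. [folklore] -/
theorem covCurlDiff_regauge (w : Site d → (Matrix n n ℂ)ˣ) (W : Site d → Fin d → (Matrix n n ℂ)ˣ) (Z : Site d → Fin d → Matrix n n ℂ)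
    (x : Site d) (ρ : Fin d) (π : T4AveragingDeficitWall.Plane d) :
    Ad (gaugeAct w W x ρ) (curl (gaugeAct w W) (dirGauge w Z) (x + e ρ, π)) - curl (gaugeAct w W) (dirGauge w Z) (x, π)
      = Ad (w x) (Ad (W x ρ) (curl W Z (x + e ρ, π)) - curl W Z (x, π)) := by
  rw [curl_gaugeAct, curl_gaugeAct]
  simp only [gaugeAct]
  rw [← Ad_mul, inv_mul_cancel_right, Ad_mul, ← Ad_sub]

/-- The three norms are unchanged (unitary `w`): (Lip₁ᶜ)'s. [folklore] -/
theorem norm_covDiff_regauge [Nonempty n] {w : Site d → (Matrix n n ℂ)ˣ} (hw : ∀ x, w x ∈ unitaryUnits (Matrix n n ℂ))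
    (W : Site d → Fin d → (Matrix n n ℂ)ˣ) (Z : Site d → Fin d → Matrix n n ℂ) (x : Site d) (κ μ : Fin d) :
    ‖Ad (gaugeAct w W (x + e κ) μ) (dirGauge w Z (x + e μ) κ) - dirGauge w Z x κ‖
      = ‖Ad (W (x + e κ) μ) (Z (x + e μ) κ) - Z x κ‖ := by
  rw [covDiff_regauge, norm_Ad_of_unitary (hw _)]

/-- … (Lip₂′ᶜ)'s. [folklore] -/
theorem norm_covDiff2_regauge [Nonempty n] {w : Site d → (Matrix n n ℂ)ˣ} (hw : ∀ x, w x ∈ unitaryUnits (Matrix n n ℂ))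
    (W : Site d → Fin d → (Matrix n n ℂ)ˣ) (Z : Site d → Fin d → Matrix n n ℂ) (y : Site d) (κ μ : Fin d) :
    ‖Ad (gaugeAct w W (y + e κ) μ)
        (Ad (gaugeAct w W (y + e κ + e μ) μ) (dirGauge w Z (y + (2 : ℕ) • e μ) κ) - dirGauge w Z (y + e μ) κ)
      - (Ad (gaugeAct w W (y + e κ) μ) (dirGauge w Z (y + e μ) κ) - dirGauge w Z y κ)‖
      = ‖Ad (W (y + e κ) μ) (Ad (W (y + e κ + e μ) μ) (Z (y + (2 : ℕ) • e μ) κ) - Z (y + e μ) κ)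
          - (Ad (W (y + e κ) μ) (Z (y + e μ) κ) - Z y κ)‖ := by
  rw [covDiff2_regauge, norm_Ad_of_unitary (hw _)]

/-- … (Lip₂ᶜ)'s. [folklore] -/
theorem norm_covCurlDiff_regauge [Nonempty n] {w : Site d → (Matrix n n ℂ)ˣ} (hw : ∀ x, w x ∈ unitaryUnits (Matrix n n ℂ))
    (W : Site d → Fin d → (Matrix n n ℂ)ˣ) (Z : Site d → Fin d → Matrix n n ℂ) (x : Site d) (ρ : Fin d)
    (π : T4AveragingDeficitWall.Plane d) :
    ‖Ad (gaugeAct w W x ρ) (curl (gaugeAct w W) (dirGauge w Z) (x + e ρ, π)) - curl (gaugeAct w W) (dirGauge w Z) (x, π)‖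
      = ‖Ad (W x ρ) (curl W Z (x + e ρ, π)) - curl W Z (x, π)‖ := by
  rw [covCurlDiff_regauge, norm_Ad_of_unitary (hw _)]

/-! ## §3 The bundle: the covariant data of the ask are gauge invariant -/

/-- **THE COVARIANT DATA OF THE INTERFACE REQUEST ARE GAUGE INVARIANT.**  Unitary `w`; if the triple `(u, W, Z)` satisfies the
representation `gaugeAct u UA = vary W Z 1`, the energy bound `energyNormW L k W Z F ≤ B`, (Lip₁ᶜ) with `Λ₁`, (Lip₂′ᶜ) with `Λ₂′` and
(Lip₂ᶜ) with `Λ₂` (all planes), then so does `(w·u, gaugeAct w W, dirGauge w Z)` with the SAME `B, Λ₁, Λ₂′, Λ₂` (and conversely with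
`w⁻¹`).  So the covariant form of «T-E_w + (Lip₁ᶜ)(Lip₂ᶜ)(Lip₂′ᶜ)» is a statement about the gauge ORBIT of run B's once-averaged
minimiser, which is all the gauge-invariant functionals of route #1 see. [folklore] -/
theorem covariantData_regauge [Nonempty n] (L k : ℕ) {w : Site d → (Matrix n n ℂ)ˣ} (hw : ∀ x, w x ∈ unitaryUnits (Matrix n n ℂ))
    (u : Site d → (Matrix n n ℂ)ˣ) {UA W : Site d → Fin d → (Matrix n n ℂ)ˣ} {Z : Site d → Fin d → Matrix n n ℂ}
    (F : Finset (Site d)) {B Λ₁ Λ₂' Λ₂ : ℝ} (hrep : gaugeAct u UA = vary W Z 1) (hE : energyNormW L k W Z F ≤ B)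
    (h1 : ∀ (κ : Fin d) (x : Site d) (μ : Fin d), ‖Ad (W (x + e κ) μ) (Z (x + e μ) κ) - Z x κ‖ ≤ Λ₁)
    (h2 : ∀ (κ μ : Fin d) (y : Site d),
      ‖Ad (W (y + e κ) μ) (Ad (W (y + e κ + e μ) μ) (Z (y + (2 : ℕ) • e μ) κ) - Z (y + e μ) κ)
        - (Ad (W (y + e κ) μ) (Z (y + e μ) κ) - Z y κ)‖ ≤ Λ₂')
    (h3 : ∀ (π : T4AveragingDeficitWall.Plane d) (x : Site d) (ρ : Fin d),
      ‖Ad (W x ρ) (curl W Z (x + e ρ, π)) - curl W Z (x, π)‖ ≤ Λ₂) :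
    gaugeAct (w * u) UA = vary (gaugeAct w W) (dirGauge w Z) 1 ∧
    energyNormW L k (gaugeAct w W) (dirGauge w Z) F ≤ B ∧
    (∀ (κ : Fin d) (x : Site d) (μ : Fin d),
      ‖Ad (gaugeAct w W (x + e κ) μ) (dirGauge w Z (x + e μ) κ) - dirGauge w Z x κ‖ ≤ Λ₁) ∧
    (∀ (κ μ : Fin d) (y : Site d),
      ‖Ad (gaugeAct w W (y + e κ) μ)
          (Ad (gaugeAct w W (y + e κ + e μ) μ) (dirGauge w Z (y + (2 : ℕ) • e μ) κ) - dirGauge w Z (y + e μ) κ)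
        - (Ad (gaugeAct w W (y + e κ) μ) (dirGauge w Z (y + e μ) κ) - dirGauge w Z y κ)‖ ≤ Λ₂') ∧
    (∀ (π : T4AveragingDeficitWall.Plane d) (x : Site d) (ρ : Fin d),
      ‖Ad (gaugeAct w W x ρ) (curl (gaugeAct w W) (dirGauge w Z) (x + e ρ, π))
        - curl (gaugeAct w W) (dirGauge w Z) (x, π)‖ ≤ Λ₂) := by
  refine ⟨gaugeAct_gaugeAct_eq_vary w u hrep, ?_, fun κ x μ => ?_, fun κ μ y => ?_, fun π x ρ => ?_⟩
  · rw [energyNormW_regauge L k hw]; exact hE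
  · rw [norm_covDiff_regauge hw]; exact h1 κ x μ
  · rw [norm_covDiff2_regauge hw]; exact h2 κ μ y
  · rw [norm_covCurlDiff_regauge hw]; exact h3 π x ρ

end

end Summit.QuantumFields.BalabanUV.T4Continuum.NE7EtaRegauging
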